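import Literature.Analysis.PDE.ChartOperator
import Mathlib.MeasureTheory.Integral.DominatedConvergence
import HarnessLib

/-!
# The duality form of the localised operator and its weak sequential continuity

Operator layer of the energy-method programme for short-time existence of quasilinear strictly
parabolic second-order systems on a closed manifold (hypothesis `hQL` of
`Literature.Geometry.Riemannian.ricciFlow_shortTime_existence_of_quasilinear`). For chart data `𝒟`
(`ChartOperator.lean`) the localised operator `𝒜̃_k(U) = Δ U_k + Fop k U` on `H = 𝐇_s` is put in
the DUALITY FORM required by Kato–Lai's Theorem A on the canonical triplet `V ⊂ H ⊂ V*`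
(`KatoLai.thmA_form`, tree file `FluidPDE/KatoLaiCanonicalTriplet.lean`), `V = 𝐇_{s+d}`,
`d = s + dim + 2`:

* `Hs.compWord k v'` — extraction of the `L²` component of word `v'`; `lapM k : 𝐇_{s+d} →L L²`,
  `lapM k v = Δ Λ_s v_k` in word form, and the Laplacian part of the form
  `lapPairL k U v = ⟪U_k, Δ Λ_s v_k⟫_{L²}` (`= (v_k, Δ U_k)_{H^s}` on smooth data);
* `chartForm 𝒟 hs Θ U = -Θ(U) Σ_k (lapPairL k U + pairL k (Fop k U))` — the form
  `B(U) ∈ V*`, `B(U)(v) = -Θ(U) (v, 𝒜̃(U))_{H^s}`, for an arbitrary scalar cut-off functional `Θ`;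
* `tendsto_Fop_of_weak`, `chartForm_tendsto_of_weak` — **weak sequential continuity along
  bounded sequences**: if `Uₙ ⇀ U` weakly in `𝐇_s` with `‖Uₙ‖` bounded and `Θ(Uₙ) → Θ(U)`, then
  `B(Uₙ)(v) → B(U)(v)` for every `v ∈ V` (the Laplacian part is a continuous linear functional
  of `U`; the nonlinear part converges by dominated convergence, its integrand converging
  pointwise because point evaluations are continuous linear, and being uniformly bounded on the
  ball containing all supports) — hypothesis "`A` sequentially weakly continuous" of Kato–Lai's
  Theorem A. [cite: KatoLai1984, §3 Thm. A (p. 18)]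

Everything is proved; no named fact and no `sorry` is introduced.

## References

* T. Kato, C. Y. Lai, Nonlinear evolution equations and the Euler flow, J. Funct. Anal. 56
  (1984) 15–28, §3, Thm. A. [KatoLai1984]
* M. E. Taylor, *Partial differential equations III*, 2nd ed., Springer 2011, Ch. 15, §7.
  [TaylorPDEIII2011]
-/

noncomputable section

open MeasureTheory Set Function Filter Metric
open scoped ContDiff Topology RealInnerProductSpace ENNReal NNReal

namespace Literature.Analysis.PDE

open Literature.Analysis.FunctionSpaces

variable {ι : Type*} [Fintype ι] [DecidableEq ι]
variable {W : Type*} [NormedAddCommGroup W] [InnerProductSpace ℝ W] [CompleteSpace W]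
variable {N s : ℕ}

/-! ### Extraction of word components and the Laplacian part -/

/-- Extraction of the `L²` component of the genuine word `v'` of the `k`-th map:
`𝐇_S → L²(ℝⁿ; W)`. [folklore] -/
def Hs.compWord {S : ℕ} (k : Fin N) (v' : List ι) (h : v'.length ≤ S) :
    Hs W N S ι →L[ℝ] Lp W 2 (volume : Measure (EuclideanSpace ℝ ι)) :=
  ((PiLp.proj 2 (𝕜 := ℝ) (fun _ : Fin N × OWord ι S => W) (k, OWord.ofList v' h)).compLpL 2
    (volume : Measure (EuclideanSpace ℝ ι))).comp (Hs W N S ι).subtypeL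

omit [DecidableEq ι] [CompleteSpace W] in
/-- On smooth jets the word component is the word derivative, a.e. [folklore] -/
theorem coeFn_compWord_jetH {S : ℕ} (k : Fin N) (v' : List ι) (h : v'.length ≤ S)
    (u : smoothCS W N ι) :
    (Hs.compWord k v' h (jetH S u) : EuclideanSpace ℝ ι → W) =ᵐ[volume] cwd v' (u.1 k) := by
  refine (show (Hs.compWord k v' h (jetH S u) : EuclideanSpace ℝ ι → W) =ᵐ[volume]
      fun y => (PiLp.proj 2 (𝕜 := ℝ) (fun _ : Fin N × OWord ι S => W) (k, OWord.ofList v' h))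
        ((jetL S u : EuclideanSpace ℝ ι → JetVal W N S ι) y) from
    ContinuousLinearMap.coeFn_compLpL _ _).trans ?_
  filter_upwards [coeFn_jetL (s := S) u] with y hy
  rw [hy]
  simp [owd_ofList]

omit [DecidableEq ι] in
/-- Words `[i, i] ++ red w ++ red w` are short enough. [folklore] -/
theorem length_lapWord_le (i : ι) (w : OWord ι s) :
    ([i, i] ++ w.red ++ w.red).length ≤ s + dd s ι := by
  have := w.length_red_le
  simp [dd]; omega

/-- **`lapM k v = Δ Λ_s v_k` in word form**: `Σ_w Σ_i (-1)^{|red w|} ∂_i ∂_i ∂_w ∂_w v_k`, as a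
continuous linear map into `L²`. [folklore] -/
def Hs.lapM (k : Fin N) : Hs W N (s + dd s ι) ι →L[ℝ] Lp W 2 (volume : Measure (EuclideanSpace ℝ ι)) :=
  ∑ w : OWord ι s, ∑ i : ι, ((-1 : ℝ) ^ w.red.length) •
    Hs.compWord k ([i, i] ++ w.red ++ w.red) (length_lapWord_le i w)

/-- **The Laplacian part of the form**: `lapPairL k U v = ⟪U_k, Δ Λ_s v_k⟫_{L²}`. [folklore] -/
def Hs.lapPairL (k : Fin N) (U : Hs W N s ι) : Hs W N (s + dd s ι) ι →L[ℝ] ℝ :=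
  ((innerSL ℝ (Hs.compLp k U) : Lp W 2 (volume : Measure (EuclideanSpace ℝ ι)) →L[ℝ] ℝ)).comp
    (Hs.lapM k)

omit [DecidableEq ι] [CompleteSpace W] in
/-- Value of `lapPairL`. [folklore] -/
theorem lapPairL_apply (k : Fin N) (U : Hs W N s ι) (v : Hs W N (s + dd s ι) ι) :
    Hs.lapPairL k U v = ⟪Hs.compLp k U, Hs.lapM k v⟫ := rfl

omit [DecidableEq ι] [CompleteSpace W] in
/-- `lapPairL k U v` is a continuous linear functional of `U` for fixed `v`. [folklore] -/
theorem lapPairL_apply_eq_clm (k : Fin N) (v : Hs W N (s + dd s ι) ι) (U : Hs W N s ι) :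
    Hs.lapPairL k U v =
      (((innerSL ℝ (Hs.lapM k v) : Lp W 2 (volume : Measure (EuclideanSpace ℝ ι)) →L[ℝ] ℝ)).comp
        (Hs.compLp k)) U := by
  rw [lapPairL_apply, ContinuousLinearMap.comp_apply, innerSL_apply_apply, real_inner_comm]

/-! ### The duality form -/

namespace ChartData

variable (𝒟 : ChartData ι W N)

/-- **The duality form of the localised operator**:
`chartForm 𝒟 hs Θ U = -Θ(U) Σ_k (lapPairL k U + pairL k (Fop k U))`, i.e.
`B(U)(v) = -Θ(U) (v, Δ U + Fop U)_{H^s} = -Θ(U) (v, 𝒜̃(U))_{H^s}` (`dim + 2 ≤ s`).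
[cite: KatoLai1984, §3 Thm. A (p. 18)] -/
def chartForm (hs : Fintype.card ι + 2 ≤ s) (Θ : Hs W N s ι → ℝ) (U : Hs W N s ι) :
    Hs W N (s + dd s ι) ι →L[ℝ] ℝ :=
  (-Θ U) • ∑ k : Fin N, (Hs.lapPairL k U +
    Hs.pairL k (𝒟.continuous_Fop k hs U) (𝒟.hasCompactSupport_Fop k U))

/-- Value of the duality form. [folklore] -/
theorem chartForm_apply (hs : Fintype.card ι + 2 ≤ s) (Θ : Hs W N s ι → ℝ) (U : Hs W N s ι)
    (v : Hs W N (s + dd s ι) ι) :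
    𝒟.chartForm hs Θ U v = -Θ U * ∑ k : Fin N, (⟪Hs.compLp k U, Hs.lapM k v⟫ +
      ∫ y, ⟪Hs.lamEv k y v, 𝒟.Fop k U y⟫) := by
  simp only [chartForm, FunLike.coe_smul, Pi.smul_apply, smul_eq_mul,
    FunLike.coe_sum, Finset.sum_apply, add_apply, lapPairL_apply, pairL_apply]

/-! ### Weak sequential continuity along bounded sequences -/

/-- **Pointwise convergence of the jets along weakly convergent sequences**: point evaluations
are continuous linear. [folklore] -/
theorem tendsto_ev_of_weak [FiniteDimensional ℝ W] {U : ℕ → Hs W N s ι} {U' : Hs W N s ι}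
    (hw : ∀ h : Hs W N s ι, Tendsto (fun n => ⟪h, U n⟫) atTop (𝓝 ⟪h, U'⟫))
    (k : Fin N) (v : List ι) (y : EuclideanSpace ℝ ι) :
    Tendsto (fun n => Hs.ev k v y (U n)) atTop (𝓝 (Hs.ev k v y U')) :=
  tendsto_clm_of_weak (H := Hs W N s ι) (Hs.ev k v y) hw

/-- Pointwise convergence of the reconstruction. [folklore] -/
theorem tendsto_ghat_of_weak [FiniteDimensional ℝ W] {U : ℕ → Hs W N s ι} {U' : Hs W N s ι}
    (hw : ∀ h : Hs W N s ι, Tendsto (fun n => ⟪h, U n⟫) atTop (𝓝 ⟪h, U'⟫))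
    (k : Fin N) (y : EuclideanSpace ℝ ι) :
    Tendsto (fun n => 𝒟.ghat k (U n) y) atTop (𝓝 (𝒟.ghat k U' y)) := by
  simp only [ghat_apply_eq]
  exact tendsto_finsetSum _ fun j _ => (tendsto_ev_of_weak hw j [] _).const_smul _

/-- Pointwise convergence of the formal first derivatives of the reconstruction. [folklore] -/
theorem tendsto_dghat_of_weak [FiniteDimensional ℝ W] {U : ℕ → Hs W N s ι} {U' : Hs W N s ι}
    (hw : ∀ h : Hs W N s ι, Tendsto (fun n => ⟪h, U n⟫) atTop (𝓝 ⟪h, U'⟫))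
    (k : Fin N) (i : ι) (y : EuclideanSpace ℝ ι) :
    Tendsto (fun n => 𝒟.dghat k (U n) i y) atTop (𝓝 (𝒟.dghat k U' i y)) := by
  simp only [dghat]
  refine tendsto_finsetSum _ fun j _ => Tendsto.add ?_ ?_
  · exact (tendsto_ev_of_weak hw j [] _).const_smul _
  · exact (tendsto_finsetSum _ fun l _ => (tendsto_ev_of_weak hw j [l] _).const_smul _).const_smul _

/-- Pointwise convergence of the first-order jet. [folklore] -/
theorem tendsto_jet1_of_weak [FiniteDimensional ℝ W] {U : ℕ → Hs W N s ι} {U' : Hs W N s ι}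
    (hw : ∀ h : Hs W N s ι, Tendsto (fun n => ⟪h, U n⟫) atTop (𝓝 ⟪h, U'⟫))
    (k : Fin N) (y : EuclideanSpace ℝ ι) :
    Tendsto (fun n => 𝒟.jet1 k (U n) y) atTop (𝓝 (𝒟.jet1 k U' y)) :=
  (𝒟.tendsto_ghat_of_weak hw k y).prodMk_nhds
    (tendsto_pi_nhds.2 fun i => 𝒟.tendsto_dghat_of_weak hw k i y)

/-- **Pointwise convergence of `Fop` along weakly convergent sequences.** [folklore] -/
theorem tendsto_Fop_of_weak [FiniteDimensional ℝ W] {U : ℕ → Hs W N s ι} {U' : Hs W N s ι}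
    (hw : ∀ h : Hs W N s ι, Tendsto (fun n => ⟪h, U n⟫) atTop (𝓝 ⟪h, U'⟫))
    (k : Fin N) (y : EuclideanSpace ℝ ι) :
    Tendsto (fun n => 𝒟.Fop k (U n) y) atTop (𝓝 (𝒟.Fop k U' y)) := by
  have hjet := 𝒟.tendsto_jet1_of_weak hw k y
  have hb : ∀ i i', Tendsto (fun n => 𝒟.b k (y, 𝒟.jet1 k (U n) y) i i') atTop
      (𝓝 (𝒟.b k (y, 𝒟.jet1 k U' y) i i')) := fun i i' => by
    have h1 : Tendsto (fun n => 𝒟.b k (y, 𝒟.jet1 k (U n) y)) atTop (𝓝 (𝒟.b k (y, 𝒟.jet1 k U' y))) :=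
      ((𝒟.contDiff_b k).continuous.tendsto _).comp (tendsto_const_nhds.prodMk_nhds hjet)
    exact ((continuous_apply i').tendsto _).comp (((continuous_apply i).tendsto _).comp h1)
  have ha : ∀ i i', Tendsto (fun n => 𝒟.a k (y, 𝒟.jet1 k (U n) y) i i') atTop
      (𝓝 (𝒟.a k (y, 𝒟.jet1 k U' y) i i')) := fun i i' => tendsto_const_nhds.add (hb i i')
  have hf : Tendsto (fun n => 𝒟.f k (y, 𝒟.jet1 k (U n) y)) atTop (𝓝 (𝒟.f k (y, 𝒟.jet1 k U' y))) :=
    ((𝒟.contDiff_f k).continuous.tendsto _).comp (tendsto_const_nhds.prodMk_nhds hjet)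
  have hg := 𝒟.tendsto_ghat_of_weak hw k y
  have hdg := fun i => 𝒟.tendsto_dghat_of_weak hw k i y
  simp only [Fop, ell]
  refine Tendsto.add (tendsto_finsetSum _ fun i _ => tendsto_finsetSum _ fun i' _ =>
    (hb i i').smul (tendsto_ev_of_weak hw k [i, i'] y)) (Tendsto.add ?_ (hf.const_smul _))
  refine Tendsto.neg (tendsto_finsetSum _ fun i _ => tendsto_finsetSum _ fun i' _ =>
    (ha i i').smul ?_)
  exact (((hdg i').const_smul _).add ((hdg i).const_smul _)).add (hg.const_smul _)

omit [DecidableEq ι] [CompleteSpace W] in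
/-- Bounds for the fixed data of a transfer: `|m|`, `|∂ᵢ m|` everywhere and `|(∂ᵢ τ)_l|` on
`tsupport m`. [folklore] -/
theorem _root_.Literature.Analysis.PDE.TransferData.exists_bounds (D : TransferData ι) :
    ∃ M : ℝ, 0 ≤ M ∧ (∀ y, |D.m y| ≤ M) ∧ (∀ i y, |fderiv ℝ D.m y (bv i)| ≤ M) ∧
      (∀ i l, ∀ y ∈ tsupport D.m, |(fderiv ℝ D.τ y (bv i)) l| ≤ M) := by
  obtain ⟨M₁, hM₁0, hM₁⟩ := exists_bound_cwd_of_hasCompactSupport D.contDiff_m D.hasCompactSupport_m 1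
  have hK : IsCompact (tsupport D.m) := D.hasCompactSupport_m
  have hcont : ∀ i l, ContinuousOn (fun y => (fderiv ℝ D.τ y (bv i)) l) (tsupport D.m) := by
    intro i l
    have h1 : ContinuousOn (fun y => fderiv ℝ D.τ y (bv i)) D.Ω :=
      (D.contDiffOn_τ.continuousOn_fderiv_of_isOpen D.isOpen_Ω (by norm_cast)).clm_apply
        continuousOn_const
    exact ((EuclideanSpace.proj (𝕜 := ℝ) l).continuous.comp_continuousOn h1).mono D.tsupport_m_subset
  have hb : ∀ i l, ∃ M : ℝ, ∀ y ∈ tsupport D.m, |(fderiv ℝ D.τ y (bv i)) l| ≤ M := fun i l => by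
    obtain ⟨M, hM⟩ := hK.exists_bound_of_continuousOn (hcont i l)
    exact ⟨M, fun y hy => by simpa [Real.norm_eq_abs] using hM y hy⟩
  choose M₂ hM₂ using hb
  have hS : 0 ≤ ∑ i, ∑ l, |M₂ i l| :=
    Finset.sum_nonneg fun i _ => Finset.sum_nonneg fun l _ => abs_nonneg _
  refine ⟨M₁ + ∑ i, ∑ l, |M₂ i l|, add_nonneg hM₁0 hS, fun y => ?_, fun i y => ?_, fun i l y hy => ?_⟩
  · have h := hM₁ [] (by simp) y
    simp only [cwd_nil, Real.norm_eq_abs] at h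
    linarith
  · have h := hM₁ [i] (by simp) y
    simp only [cwd_singleton, Real.norm_eq_abs] at h
    linarith
  · have h1 : |(fderiv ℝ D.τ y (bv i)) l| ≤ |M₂ i l| := (hM₂ i l y hy).trans (le_abs_self _)
    have h2 : |M₂ i l| ≤ ∑ i, ∑ l, |M₂ i l| :=
      (Finset.single_le_sum (f := fun l => |M₂ i l|) (fun l _ => abs_nonneg _) (Finset.mem_univ l)).trans
        (Finset.single_le_sum (f := fun i => ∑ l, |M₂ i l|) (fun i _ => by positivity)
          (Finset.mem_univ i))
    linarith

/-- **Uniform bound for the first-order jet on bounded sets** (`dim + 1 ≤ s`). [folklore] -/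
theorem exists_norm_jet1_le (hs : Fintype.card ι + 1 ≤ s) {B : ℝ} (hB : 0 ≤ B) :
    ∃ MJ : ℝ, 0 ≤ MJ ∧ ∀ (k : Fin N) (U : Hs W N s ι), ‖U‖ ≤ B → ∀ y, ‖𝒟.jet1 k U y‖ ≤ MJ := by
  obtain ⟨C, hC0, hC⟩ := exists_norm_ev_le (W := W) (N := N) (ι := ι) (s := s) (m := 1)
    (by omega) 𝒟.R_pos
  have hT := fun k j => (𝒟.T k j).exists_bounds
  choose M hM0 hMm hMdm hMτ using hT
  -- evaluation bound at transferred points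
  have hev : ∀ (k j : Fin N) (U : Hs W N s ι), ‖U‖ ≤ B → ∀ (v : List ι), v.length ≤ 1 →
      ∀ y ∈ tsupport (𝒟.T k j).m, ‖Hs.ev j v ((𝒟.T k j).τ y) U‖ ≤ C * B := by
    intro k j U hU v hv y hy
    have hτy : (𝒟.T k j).τ y ∈ closedBall (0 : EuclideanSpace ℝ ι) 𝒟.R :=
      ball_subset_closedBall (𝒟.image_τ k j ⟨y, hy, rfl⟩)
    exact (hC j v hv _ hτy U).trans (mul_le_mul_of_nonneg_left hU hC0)
  set MJ : ℝ := ∑ k : Fin N, ∑ j : Fin N, M k j * (C * B) * (2 + Fintype.card ι * M k j) with hMJ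
  have hMJ0 : 0 ≤ MJ := Finset.sum_nonneg fun k _ => Finset.sum_nonneg fun j _ => by
    have := hM0 k j; positivity
  refine ⟨MJ, hMJ0, fun k U hU y => ?_⟩
  -- each transfer term
  have hg : ‖𝒟.ghat k U y‖ ≤ ∑ j, M k j * (C * B) := by
    rw [ghat_apply_eq]
    refine (norm_sum_le _ _).trans (Finset.sum_le_sum fun j _ => ?_)
    by_cases hy : y ∈ tsupport (𝒟.T k j).m
    · rw [norm_smul, Real.norm_eq_abs]
      exact mul_le_mul (hMm k j y) (hev k j U hU [] (by simp) y hy) (norm_nonneg _) (hM0 k j)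
    · rw [image_eq_zero_of_notMem_tsupport hy, zero_smul, norm_zero]
      have := hM0 k j; positivity
  have hdg : ∀ i, ‖𝒟.dghat k U i y‖ ≤ ∑ j, M k j * (C * B) * (1 + Fintype.card ι * M k j) := by
    intro i
    simp only [dghat]
    refine (norm_sum_le _ _).trans (Finset.sum_le_sum fun j _ => ?_)
    by_cases hy : y ∈ tsupport (𝒟.T k j).m
    · refine (norm_add_le _ _).trans ?_
      have h1 : ‖fderiv ℝ (𝒟.T k j).m y (bv i) • Hs.ev j [] ((𝒟.T k j).τ y) U‖ ≤ M k j * (C * B) := by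
        rw [norm_smul, Real.norm_eq_abs]
        exact mul_le_mul (hMdm k j i y) (hev k j U hU [] (by simp) y hy) (norm_nonneg _) (hM0 k j)
      have h2 : ‖(𝒟.T k j).m y • ∑ l, ((fderiv ℝ (𝒟.T k j).τ y (bv i)) l) •
          Hs.ev j [l] ((𝒟.T k j).τ y) U‖ ≤ M k j * (Fintype.card ι * (M k j * (C * B))) := by
        rw [norm_smul, Real.norm_eq_abs]
        refine mul_le_mul (hMm k j y) ?_ (norm_nonneg _) (hM0 k j)
        refine (norm_sum_le _ _).trans ?_
        calc ∑ l, ‖((fderiv ℝ (𝒟.T k j).τ y (bv i)) l) • Hs.ev j [l] ((𝒟.T k j).τ y) U‖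
            ≤ ∑ _l : ι, M k j * (C * B) := Finset.sum_le_sum fun l _ => by
              rw [norm_smul, Real.norm_eq_abs]
              exact mul_le_mul (hMτ k j i l y hy) (hev k j U hU [l] (by simp) y hy) (norm_nonneg _)
                (hM0 k j)
          _ = Fintype.card ι * (M k j * (C * B)) := by
              rw [Finset.sum_const, nsmul_eq_mul, Finset.card_univ]
      calc _ ≤ M k j * (C * B) + M k j * (Fintype.card ι * (M k j * (C * B))) := add_le_add h1 h2
        _ = M k j * (C * B) * (1 + Fintype.card ι * M k j) := by ring
    · have h0 : (𝒟.T k j).m y = 0 := image_eq_zero_of_notMem_tsupport hy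
      have h1 : fderiv ℝ (𝒟.T k j).m y (bv i) = 0 := by
        have : y ∉ tsupport (fun y => fderiv ℝ (𝒟.T k j).m y (bv i)) := fun h =>
          hy (tsupport_fderiv_apply_subset ℝ (bv i) h)
        exact image_eq_zero_of_notMem_tsupport (f := fun y => fderiv ℝ (𝒟.T k j).m y (bv i)) this
      rw [h0, h1, zero_smul, zero_smul, add_zero, norm_zero]
      have := hM0 k j; positivity
  -- assemble with the product/pi norms
  have hterm : ∀ j, M k j * (C * B) ≤ M k j * (C * B) * (2 + Fintype.card ι * M k j) := fun j => by
    have h := hM0 k j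
    have h1 : (0 : ℝ) ≤ Fintype.card ι * M k j := by positivity
    exact le_mul_of_one_le_right (by positivity) (by linarith)
  have hterm' : ∀ j, M k j * (C * B) * (1 + Fintype.card ι * M k j) ≤
      M k j * (C * B) * (2 + Fintype.card ι * M k j) := fun j => by
    have h := hM0 k j
    exact mul_le_mul_of_nonneg_left (by linarith) (by positivity)
  have hpos : ∀ k', 0 ≤ ∑ j, M k' j * (C * B) * (2 + Fintype.card ι * M k' j) := fun k' =>
    Finset.sum_nonneg fun j _ => by have := hM0 k' j; positivity
  have hk : ∑ j, M k j * (C * B) * (2 + Fintype.card ι * M k j) ≤ MJ :=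
    Finset.single_le_sum (f := fun k => ∑ j, M k j * (C * B) * (2 + Fintype.card ι * M k j))
      (fun k _ => hpos k) (Finset.mem_univ k)
  rw [jet1, Prod.norm_def]
  refine max_le (hg.trans ((Finset.sum_le_sum fun j _ => hterm j).trans hk)) ?_
  refine (pi_norm_le_iff_of_nonneg hMJ0).2 fun i => ?_
  exact (hdg i).trans ((Finset.sum_le_sum fun j _ => hterm' j).trans hk)

/-- **Uniform bound for `Fop` on bounded sets**: for `dim + 2 ≤ s` and `B ≥ 0` there is `M` with
`‖Fop k U y‖ ≤ M` for all `y` and all `U` with `‖U‖ ≤ B`. [folklore] -/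
theorem exists_norm_Fop_le [FiniteDimensional ℝ W] (hs : Fintype.card ι + 2 ≤ s) {B : ℝ}
    (hB : 0 ≤ B) :
    ∃ M : ℝ, 0 ≤ M ∧ ∀ (k : Fin N) (U : Hs W N s ι), ‖U‖ ≤ B → ∀ y, ‖𝒟.Fop k U y‖ ≤ M := by
  obtain ⟨C, hC0, hC⟩ := exists_norm_ev_le (W := W) (N := N) (ι := ι) (s := s) (m := 2)
    (by omega) 𝒟.R_pos
  obtain ⟨MJ, hMJ0, hMJ⟩ := 𝒟.exists_norm_jet1_le (s := s) (by omega) hB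
  -- bounds for `α` and its derivatives up to order two
  have hα : ∀ k, ∃ M : ℝ, 0 ≤ M ∧ ∀ a : List ι, a.length ≤ 2 → ∀ x, ‖cwd a (𝒟.α k) x‖ ≤ M :=
    fun k => exists_bound_cwd_of_hasCompactSupport (𝒟.contDiff_α k) (𝒟.hasCompactSupport_α k) 2
  choose Mα hMα0 hMα using hα
  -- bounds for `b` and `f` on the compact jet region
  have hK : IsCompact (closedBall (0 : EuclideanSpace ℝ ι) 𝒟.R ×ˢ closedBall (0 : W × (ι → W)) MJ) :=
    (isCompact_closedBall _ _).prod (isCompact_closedBall _ _)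
  have hbf : ∀ k, ∃ M : ℝ, 0 ≤ M ∧ (∀ z ∈ closedBall (0 : EuclideanSpace ℝ ι) 𝒟.R ×ˢ
      closedBall (0 : W × (ι → W)) MJ, ‖𝒟.b k z‖ ≤ M ∧ ‖𝒟.f k z‖ ≤ M) := fun k => by
    obtain ⟨M₁, hM₁⟩ := hK.exists_bound_of_continuousOn (𝒟.contDiff_b k).continuous.continuousOn
    obtain ⟨M₂, hM₂⟩ := hK.exists_bound_of_continuousOn (𝒟.contDiff_f k).continuous.continuousOn
    exact ⟨max (max M₁ M₂) 0, le_max_right _ _, fun z hz =>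
      ⟨(hM₁ z hz).trans ((le_max_left _ _).trans (le_max_left _ _)),
       (hM₂ z hz).trans ((le_max_right _ _).trans (le_max_left _ _))⟩⟩
  choose Mb hMb0 hMb using hbf
  set n : ℝ := ((Fintype.card ι : ℕ) : ℝ) with hn
  set term : Fin N → ℝ := fun k =>
    n * n * (Mb k * (C * B)) + (n * n * ((1 + Mb k) * (3 * (Mα k * MJ))) + Mα k * Mb k) with hterm
  have hterm0 : ∀ k, 0 ≤ term k := fun k => by
    have := hMb0 k; have := hMα0 k; positivity
  refine ⟨∑ k, term k, Finset.sum_nonneg fun k _ => hterm0 k, fun k U hU y => ?_⟩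
  by_cases hy : 𝒟.R ≤ ‖y‖
  · rw [𝒟.Fop_eq_zero k U hy, norm_zero]; exact Finset.sum_nonneg fun k _ => hterm0 k
  have hyb : y ∈ closedBall (0 : EuclideanSpace ℝ ι) 𝒟.R := by
    rw [mem_closedBall, dist_zero_right]; linarith
  have hz : (y, 𝒟.jet1 k U y) ∈ closedBall (0 : EuclideanSpace ℝ ι) 𝒟.R ×ˢ
      closedBall (0 : W × (ι → W)) MJ :=
    ⟨hyb, by rw [mem_closedBall, dist_zero_right]; exact hMJ k U hU y⟩
  -- pointwise bounds for the ingredients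
  have hb : ∀ i i', |𝒟.b k (y, 𝒟.jet1 k U y) i i'| ≤ Mb k := fun i i' =>
    ((Real.norm_eq_abs _).symm.le.trans (norm_le_pi_norm _ i')).trans
      ((norm_le_pi_norm _ i).trans (hMb k _ hz).1)
  have ha : ∀ i i', |𝒟.a k (y, 𝒟.jet1 k U y) i i'| ≤ 1 + Mb k := fun i i' => by
    unfold a
    refine (abs_add_le _ _).trans (add_le_add ?_ (hb i i'))
    split_ifs <;> simp
  have hf : ‖𝒟.f k (y, 𝒟.jet1 k U y)‖ ≤ Mb k := (hMb k _ hz).2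
  have hev : ∀ i i', ‖Hs.ev k [i, i'] y U‖ ≤ C * B := fun i i' =>
    (hC k [i, i'] (by simp) y hyb U).trans (mul_le_mul_of_nonneg_left hU hC0)
  have hg : ‖𝒟.ghat k U y‖ ≤ MJ := (norm_fst_le (𝒟.jet1 k U y)).trans (hMJ k U hU y)
  have hdg : ∀ i, ‖𝒟.dghat k U i y‖ ≤ MJ := fun i =>
    ((norm_le_pi_norm _ i).trans (norm_snd_le (𝒟.jet1 k U y))).trans (hMJ k U hU y)
  have hα0 : |𝒟.α k y| ≤ Mα k := by simpa [Real.norm_eq_abs] using hMα k [] (by simp) y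
  have hα1 : ∀ i, |fderiv ℝ (𝒟.α k) y (bv i)| ≤ Mα k := fun i => by
    simpa [Real.norm_eq_abs, cwd_singleton] using hMα k [i] (by simp) y
  have hα2 : ∀ i i', |cwd [i, i'] (𝒟.α k) y| ≤ Mα k := fun i i' => by
    simpa [Real.norm_eq_abs] using hMα k [i, i'] (by simp) y
  -- the principal compact part
  have h1 : ‖∑ i, ∑ i', 𝒟.b k (y, 𝒟.jet1 k U y) i i' • Hs.ev k [i, i'] y U‖ ≤ n * n * (Mb k * (C * B)) := by
    refine (norm_sum_le _ _).trans ?_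
    calc ∑ i, ‖∑ i', 𝒟.b k (y, 𝒟.jet1 k U y) i i' • Hs.ev k [i, i'] y U‖
        ≤ ∑ _i : ι, n * (Mb k * (C * B)) := Finset.sum_le_sum fun i _ => by
          refine (norm_sum_le _ _).trans ?_
          calc ∑ i', ‖𝒟.b k (y, 𝒟.jet1 k U y) i i' • Hs.ev k [i, i'] y U‖
              ≤ ∑ _i' : ι, Mb k * (C * B) := Finset.sum_le_sum fun i' _ => by
                rw [norm_smul, Real.norm_eq_abs]
                exact mul_le_mul (hb i i') (hev i i') (norm_nonneg _) (hMb0 k)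
            _ = n * (Mb k * (C * B)) := by rw [Finset.sum_const, nsmul_eq_mul, Finset.card_univ]
      _ = n * n * (Mb k * (C * B)) := by rw [Finset.sum_const, nsmul_eq_mul, Finset.card_univ]; ring
  -- the correction `ℓ`
  have h2 : ‖𝒟.ell k U y‖ ≤ n * n * ((1 + Mb k) * (3 * (Mα k * MJ))) + Mα k * Mb k := by
    unfold ell
    refine (norm_add_le _ _).trans (add_le_add ?_ ?_)
    · rw [norm_neg]
      refine (norm_sum_le _ _).trans ?_
      calc ∑ i, ‖∑ i', 𝒟.a k (y, 𝒟.jet1 k U y) i i' •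
            ((fderiv ℝ (𝒟.α k) y (bv i)) • 𝒟.dghat k U i' y +
              (fderiv ℝ (𝒟.α k) y (bv i')) • 𝒟.dghat k U i y + (cwd [i, i'] (𝒟.α k) y) • 𝒟.ghat k U y)‖
          ≤ ∑ _i : ι, n * ((1 + Mb k) * (3 * (Mα k * MJ))) := Finset.sum_le_sum fun i _ => by
            refine (norm_sum_le _ _).trans ?_
            calc _ ≤ ∑ _i' : ι, (1 + Mb k) * (3 * (Mα k * MJ)) := Finset.sum_le_sum fun i' _ => by
                  rw [norm_smul, Real.norm_eq_abs]
                  refine mul_le_mul (ha i i') ?_ (norm_nonneg _) (by have := hMb0 k; positivity)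
                  refine (norm_add_le _ _).trans ?_
                  have e1 : ‖fderiv ℝ (𝒟.α k) y (bv i) • 𝒟.dghat k U i' y‖ ≤ Mα k * MJ := by
                    rw [norm_smul, Real.norm_eq_abs]
                    exact mul_le_mul (hα1 i) (hdg i') (norm_nonneg _) (hMα0 k)
                  have e2 : ‖fderiv ℝ (𝒟.α k) y (bv i') • 𝒟.dghat k U i y‖ ≤ Mα k * MJ := by
                    rw [norm_smul, Real.norm_eq_abs]
                    exact mul_le_mul (hα1 i') (hdg i) (norm_nonneg _) (hMα0 k)
                  have e3 : ‖cwd [i, i'] (𝒟.α k) y • 𝒟.ghat k U y‖ ≤ Mα k * MJ := by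
                    rw [norm_smul, Real.norm_eq_abs]
                    exact mul_le_mul (hα2 i i') hg (norm_nonneg _) (hMα0 k)
                  linarith [norm_add_le (fderiv ℝ (𝒟.α k) y (bv i) • 𝒟.dghat k U i' y)
                    (fderiv ℝ (𝒟.α k) y (bv i') • 𝒟.dghat k U i y)]
              _ = n * ((1 + Mb k) * (3 * (Mα k * MJ))) := by
                  rw [Finset.sum_const, nsmul_eq_mul, Finset.card_univ]
        _ = n * n * ((1 + Mb k) * (3 * (Mα k * MJ))) := by
            rw [Finset.sum_const, nsmul_eq_mul, Finset.card_univ]; ring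
    · rw [norm_smul, Real.norm_eq_abs]
      exact mul_le_mul hα0 hf (norm_nonneg _) (hMα0 k)
  calc ‖𝒟.Fop k U y‖ ≤ ‖∑ i, ∑ i', 𝒟.b k (y, 𝒟.jet1 k U y) i i' • Hs.ev k [i, i'] y U‖ + ‖𝒟.ell k U y‖ :=
        norm_add_le _ _
    _ ≤ term k := by rw [hterm]; exact add_le_add h1 h2
    _ ≤ ∑ k, term k := Finset.single_le_sum (fun k _ => hterm0 k) (Finset.mem_univ k)

/-- **Weak sequential continuity of the duality form along bounded sequences**: if `Uₙ ⇀ U`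
weakly in `𝐇_s` with `‖Uₙ‖ ≤ B` and `Θ(Uₙ) → Θ(U)`, then `B(Uₙ)(v) → B(U)(v)` for every `v`
(hypothesis "`A` sequentially weakly continuous" of Kato–Lai's Theorem A; `dim + 2 ≤ s`).
[cite: KatoLai1984, §3 Thm. A (p. 18)] -/
theorem chartForm_tendsto_of_weak [FiniteDimensional ℝ W] (hs : Fintype.card ι + 2 ≤ s)
    {Θ : Hs W N s ι → ℝ} {U : ℕ → Hs W N s ι} {U' : Hs W N s ι}
    (hw : ∀ h : Hs W N s ι, Tendsto (fun n => ⟪h, U n⟫) atTop (𝓝 ⟪h, U'⟫))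
    {B : ℝ} (hB : ∀ n, ‖U n‖ ≤ B) (hΘ : Tendsto (fun n => Θ (U n)) atTop (𝓝 (Θ U')))
    (v : Hs W N (s + dd s ι) ι) :
    Tendsto (fun n => 𝒟.chartForm hs Θ (U n) v) atTop (𝓝 (𝒟.chartForm hs Θ U' v)) := by
  have hB0 : 0 ≤ B := (norm_nonneg _).trans (hB 0)
  -- the weak limit is also bounded by `B`
  have hU' : ‖U'‖ ≤ B := by
    have h1 := hw U'
    have h2 : ∀ n, ⟪U', U n⟫ ≤ ‖U'‖ * B := fun n =>
      (real_inner_le_norm _ _).trans (mul_le_mul_of_nonneg_left (hB n) (norm_nonneg _))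
    have h3 : ⟪U', U'⟫ ≤ ‖U'‖ * B := le_of_tendsto' h1 h2
    rw [real_inner_self_eq_norm_sq] at h3
    by_cases h0 : ‖U'‖ = 0
    · rw [h0]; exact hB0
    · nlinarith [lt_of_le_of_ne (norm_nonneg U') (Ne.symm h0)]
  simp only [chartForm_apply]
  refine (hΘ.neg).mul (tendsto_finsetSum _ fun k _ => Tendsto.add ?_ ?_)
  · -- Laplacian part: a continuous linear functional of `U`
    have h := tendsto_clm_of_weak (H := Hs W N s ι) (W := ℝ)
      ((((innerSL ℝ (Hs.lapM k v) : Lp W 2 (volume : Measure (EuclideanSpace ℝ ι)) →L[ℝ] ℝ)).comp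
        (Hs.compLp k))) hw
    refine h.congr' (Eventually.of_forall fun n => ?_) |>.trans ?_
    · rw [← lapPairL_apply_eq_clm, lapPairL_apply]
    · rw [← lapPairL_apply_eq_clm, lapPairL_apply]
  · -- nonlinear part: dominated convergence
    obtain ⟨M, hM0, hM⟩ := 𝒟.exists_norm_Fop_le hs hB0
    obtain ⟨C, hC0, hC⟩ := exists_norm_lamEv_le (W := W) (N := N) (s := s) (ι := ι) 𝒟.R_pos
    refine tendsto_integral_of_dominated_convergence
      (fun y => (closedBall (0 : EuclideanSpace ℝ ι) 𝒟.R).indicator (fun _ => C * ‖v‖ * M) y)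
      (fun n => ((continuous_lamEv_apply k v).inner (𝒟.continuous_Fop k hs (U n))).aestronglyMeasurable)
      ?_ (fun n => Eventually.of_forall fun y => ?_) (Eventually.of_forall fun y => ?_)
    · exact (integrableOn_const (C := C * ‖v‖ * M) (s := closedBall (0 : EuclideanSpace ℝ ι) 𝒟.R)
        (μ := (volume : Measure (EuclideanSpace ℝ ι)))
        (isCompact_closedBall _ _).measure_lt_top.ne).integrable_indicator measurableSet_closedBall
    · by_cases hy : y ∈ closedBall (0 : EuclideanSpace ℝ ι) 𝒟.R
      · rw [indicator_of_mem hy]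
        calc ‖⟪Hs.lamEv k y v, 𝒟.Fop k (U n) y⟫‖ ≤ ‖Hs.lamEv k y v‖ * ‖𝒟.Fop k (U n) y‖ :=
              norm_inner_le_norm _ _
          _ ≤ C * ‖v‖ * M := mul_le_mul (hC k y hy v) (hM k (U n) (hB n) y) (norm_nonneg _)
              (by positivity)
      · rw [indicator_of_notMem hy]
        have hR : 𝒟.R ≤ ‖y‖ := by
          rw [mem_closedBall, dist_zero_right, not_le] at hy; exact hy.le
        rw [𝒟.Fop_eq_zero k (U n) hR, inner_zero_right, norm_zero]
    · exact ((continuous_inner.tendsto _).comp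
        (tendsto_const_nhds.prodMk_nhds (𝒟.tendsto_Fop_of_weak hw k y)))

end ChartData

end Literature.Analysis.PDE

end
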